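import Summits.BirchSwinnertonDyer.BirchSwinnertonDyer.Theorems.ResidualThetaTransportAtTwoUnramifiedRestriction
import Literature.NumberTheory.GaloisRepresentations.ContinuousH1CoefficientTransport
import Literature.NumberTheory.EllipticCurves.GreenbergVatsal2000.GreenbergSelmerGroups
import HarnessLib

/-!
# Coordinates on `H¹(H, M^f)`: an additive bijection `H¹(H, M^f) ≃ H¹(H, M)^f` compatible with conjugation, with the
# unramified conditions and with the archimedean conditions (crux (R≥)ᵖ, stub `stub_transport` v2, step (e) bookkeeping)

Route `ResidualThetaTransportAtTwo` (RTT), crux (R≥)ᵖ `ResidualThetaCountLowerPureAtTwo` (stmt-BirchSwinnertonDyer-26074),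
line «bt26-lambda» v2; seat `prover-bsd-wall-rtt-p2` g12 (`--supports`, closes nothing). HONEST FRAMING: THEOREMS ONLY (no
definition, no named fact, no instance, no `sorry`); generic Galois-cohomological bookkeeping over any number field; nothing
about any curve or count; BSD is not proved by any of this.

WHAT. `stub_transport` v2 compares the `g`-side counted set (classes of `H¹(Γ_{ℚ_∞}, A_g)[ϖ] = j_* H¹(Γ_{ℚ_∞}, V₂^f)`,
`V₂ = (W[2^∞])[2]`) with the `f`-th power of the `W`-side counted set (classes of `H¹(Γ_{ℚ_∞}, V₂)`). The bridge
`H¹(H, V₂^f) ≅ H¹(H, V₂)^f` is the tree's coordinate principle (`ContinuousH1CoefficientTransport.cohomologyCoordEquiv`, Serre I §2.2)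
for the tautological coordinate system of `M^f = (Fin f → M)`; this file packages it, for ANY discrete `Γ_K`-module `M` and any
`H ≤ Γ_K`, with the compatibilities the count needs:
* `exists_coordEquiv` — an additive bijection `e : H¹(H, M^f) ≃+ (Fin f → H¹(H, M))` with (i) `e [φ] l = [h ↦ φ h l]` on cocycles,
  (ii) `e (conj_σ x) l = conj_σ (e x l)` (`H` normal), (iii) `x ∈ unramifiedKer H M^f v ↔ ∀ l, e x l ∈ unramifiedKer H M v`,
  (iv) `x ∈ infKer H M^f w ↔ ∀ l, e x l ∈ infKer H M w`;
* `mem_unramifiedOutside_pi_iff` — hence `x ∈ unramifiedOutside H M^f p S₀ ↔ ∀ l, e x l ∈ unramifiedOutside H M p S₀`, and the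
  archimedean clause `∀ w σ, conj_σ x ∈ infKer w` splits coordinatewise likewise (`forall_conjH1_mem_infKer_pi_iff`).

References: [SerreGaloisCohomology1997] I §2.2 (cohomology of a finite product of modules), I §2.4; [GreenbergVatsal2000] §2 pp. 16–17.
-/

set_option autoImplicit false
-- the Theorems namespace of this sub repeats the summit name by design (D-0017 nested layout)
set_option linter.dupNamespace false

noncomputable section

open NumberField Field IsDedekindDomain Literature Literature.NumberTheory.EllipticCurves
  Literature.NumberTheory.EllipticCurves.GreenbergSelmer Literature.NumberTheory.EllipticCurves.GreenbergVatsal2000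
  Literature.NumberTheory.GaloisRepresentations

namespace Summit.BirchSwinnertonDyer.BirchSwinnertonDyer.Theorems.ThetaTransport

-- universe `0` throughout: the coordinate index `Fin f` lives in `Type`, and the tree's coordinate principle takes the index type in the
-- universe of the modules (all applications are over `K = ℚ`).
variable {K : Type} [Field K] [NumberField K] (H : Subgroup (absoluteGaloisGroup K))
  (M : Type) [AddCommGroup M] [DistribMulAction (absoluteGaloisGroup K) M] [TopologicalSpace M] [DiscreteTopology M]
  (f : ℕ)

/-- **Coordinates on `H¹(H, M^f)`.** There is an additive bijection `e : H¹(H, M^f) ≃+ (Fin f → H¹(H, M))` (Serre I §2.2, via the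
tree's `cohomologyCoordEquiv` for the tautological coordinate system of `M^f`) such that: (i) on cocycles `e [φ] l = [h ↦ φ h l]`;
(ii) `e (conj_σ x) l = conj_σ (e x l)` for every `σ ∈ Γ_K` (`H` normal); (iii) `x` is unramified at `v` iff every coordinate is;
(iv) `x` restricts to `0` on `H ⊓ D_w` iff every coordinate does. [cite: SerreGaloisCohomology1997, I §2.2 and I §2.4] -/
theorem exists_coordEquiv [H.Normal] :
    ∃ e : subgroupH1 H (Fin f → M) ≃+ (Fin f → subgroupH1 H M),
      (∀ (φ : contOneCocycles (discreteTopRep H (Fin f → M))) (l : Fin f),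
          ∃ ψ : contOneCocycles (discreteTopRep H M), (∀ h, ψ.1 h = φ.1 h l) ∧
            e (oneCocycleClass _ φ) l = oneCocycleClass _ ψ) ∧
      (∀ (σ : absoluteGaloisGroup K) (x : subgroupH1 H (Fin f → M)) (l : Fin f),
          e (conjH1 H (Fin f → M) σ x) l = conjH1 H M σ (e x l)) ∧
      (∀ (v : HeightOneSpectrum (𝓞 K)) (x : subgroupH1 H (Fin f → M)),
          x ∈ unramifiedKer H (Fin f → M) v ↔ ∀ l, e x l ∈ unramifiedKer H M v) ∧
      (∀ (w : InfinitePlace K) (x : subgroupH1 H (Fin f → M)),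
          x ∈ infKer H (Fin f → M) w ↔ ∀ l, e x l ∈ infKer H M w) := by
  -- the tautological coordinate system of `M^f` over `H`, and over the subgroups `H ⊓ I_v`, `H ⊓ D_w`
  let Θ : (discreteTopRep H (Fin f → M)) ≃+ (Fin f → discreteTopRep H M) := AddEquiv.refl _
  have hΘ : Continuous Θ := continuous_of_discreteTopology
  have hΘ' : Continuous Θ.symm := continuous_of_discreteTopology
  have hρ : ∀ (g : H) (m : discreteTopRep H (Fin f → M)) (i : Fin f),
      Θ ((discreteTopRep H (Fin f → M)).ρ g m) i = (discreteTopRep H M).ρ g (Θ m i) := fun _ _ _ ↦ rfl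
  let e : subgroupH1 H (Fin f → M) ≃+ (Fin f → subgroupH1 H M) :=
    cohomologyCoordEquiv (ι := Fin f) (X := discreteTopRep H M) (X₁ := discreteTopRep H (Fin f → M)) Θ hΘ hΘ' hρ
  have he : ∀ x, e x = cohomologyCoord Θ hΘ hρ x := fun _ ↦ rfl
  refine ⟨e, fun φ l ↦ ?_, fun σ x l ↦ ?_, fun v x ↦ ?_, fun w x ↦ ?_⟩
  · -- (i) cocycles
    exact ⟨cocycleCoord Θ hΘ hρ φ l, fun h ↦ rfl, by
      rw [he, cohomologyCoord_oneCocycleClass]⟩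
  · -- (ii) conjugation: the compatible pair `(h ↦ σ⁻¹ h σ, m ↦ σ • m)` on `M^f` and on `M`
    rw [he, he]
    exact cohomologyCoord_map Θ hΘ hρ Θ hΘ hρ (subgroupConj H σ)
      (resHomOfEquivariant (subgroupConj H σ) (DistribSMul.toAddMonoidHom M σ) fun x m ↦ by
        simp only [DistribSMul.toAddMonoidHom_apply, Subgroup.smul_def, subgroupConj_apply_coe, smul_smul, mul_assoc,
          mul_inv_cancel_left])
      (resHomOfEquivariant (subgroupConj H σ) (DistribSMul.toAddMonoidHom (Fin f → M) σ) fun x m ↦ by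
        simp only [DistribSMul.toAddMonoidHom_apply, Subgroup.smul_def, subgroupConj_apply_coe, smul_smul, mul_assoc,
          mul_inv_cancel_left])
      (fun _ _ ↦ rfl) x l
  · -- (iii) unramified at `v`: the pair `(H ⊓ I_v ↪ H, id)`
    let Ξ : (discreteTopRep (inertiaIn H v) (Fin f → M)) ≃+ (Fin f → discreteTopRep (inertiaIn H v) M) := AddEquiv.refl _
    have hΞ : Continuous Ξ := continuous_of_discreteTopology
    have hΞ' : Continuous Ξ.symm := continuous_of_discreteTopology
    have hσ : ∀ (g : inertiaIn H v) (m : discreteTopRep (inertiaIn H v) (Fin f → M)) (i : Fin f),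
        Ξ ((discreteTopRep (inertiaIn H v) (Fin f → M)).ρ g m) i = (discreteTopRep (inertiaIn H v) M).ρ g (Ξ m i) :=
      fun _ _ _ ↦ rfl
    have key := map_eq_zero_iff_forall_cohomologyCoord Θ hΘ hρ Ξ hΞ hσ hΞ' (inertiaInToH H v)
      (resHomOfEquivariant (inertiaInToH H v) (AddMonoidHom.id M) fun _ _ ↦ rfl)
      (resHomOfEquivariant (inertiaInToH H v) (AddMonoidHom.id (Fin f → M)) fun _ _ ↦ rfl) (fun _ _ ↦ rfl) x
    rw [GreenbergVatsal2000.unramifiedKer, AddMonoidHom.mem_ker]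
    refine (Iff.trans (by rfl) key).trans (forall_congr' fun l ↦ ?_)
    rw [GreenbergVatsal2000.unramifiedKer, AddMonoidHom.mem_ker, he]
    rfl
  · -- (iv) the archimedean condition: the pair `(H ⊓ D_w ↪ H, id)`
    let Ξ : (discreteTopRep ↥(H ⊓ decompInf w) (Fin f → M)) ≃+ (Fin f → discreteTopRep ↥(H ⊓ decompInf w) M) :=
      AddEquiv.refl _
    have hΞ : Continuous Ξ := continuous_of_discreteTopology
    have hΞ' : Continuous Ξ.symm := continuous_of_discreteTopology
    have hσ : ∀ (g : ↥(H ⊓ decompInf w)) (m : discreteTopRep ↥(H ⊓ decompInf w) (Fin f → M)) (i : Fin f),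
        Ξ ((discreteTopRep ↥(H ⊓ decompInf w) (Fin f → M)).ρ g m) i = (discreteTopRep ↥(H ⊓ decompInf w) M).ρ g (Ξ m i) :=
      fun _ _ _ ↦ rfl
    have key := map_eq_zero_iff_forall_cohomologyCoord Θ hΘ hρ Ξ hΞ hσ hΞ'
      (subgroupInclusion (inf_le_left : H ⊓ decompInf w ≤ H))
      (resHomOfEquivariant (subgroupInclusion (inf_le_left : H ⊓ decompInf w ≤ H)) (AddMonoidHom.id M) fun _ _ ↦ rfl)
      (resHomOfEquivariant (subgroupInclusion (inf_le_left : H ⊓ decompInf w ≤ H)) (AddMonoidHom.id (Fin f → M))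
        fun _ _ ↦ rfl) (fun _ _ ↦ rfl) x
    rw [infKer, AddMonoidHom.mem_ker]
    refine (Iff.trans (by rfl) key).trans (forall_congr' fun l ↦ ?_)
    rw [infKer, AddMonoidHom.mem_ker, he]
    rfl

/-- **`unramifiedOutside` splits coordinatewise** along any `e` as in `exists_coordEquiv` (clauses (ii) and (iii)).
[cite: GreenbergVatsal2000, §2 pp. 16–17, 23] [cite: SerreGaloisCohomology1997, I §2.2] -/
theorem mem_unramifiedOutside_pi_iff [H.Normal] (p : ℕ) (S₀ : Set (HeightOneSpectrum (𝓞 K)))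
    (e : subgroupH1 H (Fin f → M) ≃+ (Fin f → subgroupH1 H M))
    (heconj : ∀ (σ : absoluteGaloisGroup K) (x : subgroupH1 H (Fin f → M)) (l : Fin f),
      e (conjH1 H (Fin f → M) σ x) l = conjH1 H M σ (e x l))
    (heunr : ∀ (v : HeightOneSpectrum (𝓞 K)) (x : subgroupH1 H (Fin f → M)),
      x ∈ unramifiedKer H (Fin f → M) v ↔ ∀ l, e x l ∈ unramifiedKer H M v)
    (x : subgroupH1 H (Fin f → M)) :
    x ∈ unramifiedOutside H (Fin f → M) p S₀ ↔ ∀ l, e x l ∈ unramifiedOutside H M p S₀ := by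
  simp only [mem_unramifiedOutside_iff, heunr, heconj]
  exact ⟨fun h l v hv hpv σ ↦ h v hv hpv σ l, fun h v hv hpv σ l ↦ h l v hv hpv σ⟩

omit [NumberField K] in
/-- **The archimedean clause splits coordinatewise** along any `e` as in `exists_coordEquiv` (clauses (ii) and (iv)).
[cite: SerreGaloisCohomology1997, I §2.2] -/
theorem forall_conjH1_mem_infKer_pi_iff [H.Normal] (e : subgroupH1 H (Fin f → M) ≃+ (Fin f → subgroupH1 H M))
    (heconj : ∀ (σ : absoluteGaloisGroup K) (x : subgroupH1 H (Fin f → M)) (l : Fin f),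
      e (conjH1 H (Fin f → M) σ x) l = conjH1 H M σ (e x l))
    (heinf : ∀ (w : InfinitePlace K) (x : subgroupH1 H (Fin f → M)),
      x ∈ infKer H (Fin f → M) w ↔ ∀ l, e x l ∈ infKer H M w)
    (x : subgroupH1 H (Fin f → M)) :
    (∀ (w : InfinitePlace K) (σ : absoluteGaloisGroup K), conjH1 H (Fin f → M) σ x ∈ infKer H (Fin f → M) w) ↔
      ∀ l (w : InfinitePlace K) (σ : absoluteGaloisGroup K), conjH1 H M σ (e x l) ∈ infKer H M w := by
  simp only [heinf, heconj]
  exact ⟨fun h l w σ ↦ h w σ l, fun h w σ l ↦ h l w σ⟩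

end Summit.BirchSwinnertonDyer.BirchSwinnertonDyer.Theorems.ThetaTransport

end
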